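import Literature.AlgebraicGeometry.Resolution.OneDimAnalyticallyUnramifiedFinite
import Literature.AlgebraicGeometry.Resolution.RegularHomReduced
import Literature.AlgebraicGeometry.Resolution.ExcellentRingsProofs
import HarnessLib

/-!
# One-dimensional local domains `R_𝔔/𝔮R_𝔔` of a local G-ring have finite normalization
# ("Now we use the excellence of `R`. Then `N` is a finite `R̄`-module" — HIO, proof of Thm. (30.2))

Topic: `Literature/AlgebraicGeometry/Resolution`. In the proof of Bennett's inequality
(Herrmann–Ikeda–Orbanz, *Equimultiplicity and Blowing up*, Thm. (30.2), p. 252) the excellence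
of `R` is used exactly once: the normalization `N` of the one-dimensional local domain
`R̄ = R/𝔭` (after reduction to `dim R/𝔭 = 1`, applied to the local rings `R_𝔔` and primes
`𝔮R_𝔔` for adjacent primes `𝔮 ⋖ 𝔔`) is a finite `R̄`-module. This file PROVES that hypothesis —
the `hFN` of `BennettHironakaLocal.lean` / `BennettDimOne.lean` — for every Noetherian local
**G-ring** `R` (in particular for quasi-excellent and excellent local rings), from the tree:
a localization and a quotient of a G-ring is a G-ring (`isGRing_of_isLocalization`,
`isGRing_of_surjective`, Matsumura §32), the completion of a reduced local G-ring is reduced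
(`IsGRing.isReduced_adicCompletion`, Stacks 07QK/07QV), and Krull's criterion "analytically
unramified one-dimensional local domains have finite normalization"
(`module_finite_integralClosure_of_isReduced_adicCompletion`, Kollár Thm. 1.101).

* `module_finite_integralClosure_range` — transport of "finite normalization" from `D` to its
  isomorphic image `D̄ ⊆ K = Frac D` (the form in which the Bennett files consume it);
* `module_finite_integralClosure_of_isGRing_of_ringKrullDim_eq_one` — a one-dimensional local
  domain which is a G-ring has finite normalization;
* `module_finite_integralClosure_range_localization_quotient_of_isGRing` — **for a local G-ring
  `R`, a prime `𝔔` and a prime `𝔮'` of `R_𝔔` with `dim R_𝔔/𝔮' = 1`, the normalization of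
  `R_𝔔/𝔮'` is finite** (the hypothesis `hFN`).

No definitions and no named facts are introduced.

## Sources

* M. Herrmann, S. Ikeda, U. Orbanz, *Equimultiplicity and Blowing up*, Springer 1988, proof of
  Thm. (30.2), p. 252. [HerrmannIkedaOrbanz1988]
* H. Matsumura, *Commutative Ring Theory* (1986), §32, p. 260 (quotients and localizations of
  G-rings). [Matsumura1987]
* J. Kollár, *Lectures on Resolution of Singularities* (2007), Thm. 1.101. [Kollar2007]
-/

noncomputable section

open IsLocalRing

namespace Literature.AlgebraicGeometry.Resolution

universe u

/-! ## Transport to the image `D̄ ⊆ Frac D` -/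

/-- **Finite normalization, transported to the isomorphic image `D̄ = im(D → K) ⊆ K`.** If the
integral closure of the domain `D` in its fraction field `K` is a finite `D`-module, then the
integral closure of the subring `D̄ ⊆ K` in `K` is a finite `D̄`-module (same elements, same
generators). [folklore] -/
theorem module_finite_integralClosure_range {D K : Type u} [CommRing D] [IsDomain D] [Field K]
    [Algebra D K] [IsFractionRing D K] (h : Module.Finite D (integralClosure D K)) :
    Module.Finite (algebraMap D K).range (integralClosure (algebraMap D K).range K) := by
  classical
  set A₀ : Subring K := (algebraMap D K).range with hA₀
  have hinj : Function.Injective (algebraMap D K) := IsFractionRing.injective _ _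
  let e : D ≃+* A₀ := RingEquiv.ofBijective (algebraMap D K).rangeRestrict
    ⟨fun a b hab => hinj (congrArg Subtype.val hab), RingHom.rangeRestrict_surjective _⟩
  have he : ∀ d : D, ((e d : A₀) : K) = algebraMap D K d := fun _ => rfl
  -- integrality over `D` and over `A₀` agree
  have hint : ∀ z : K, IsIntegral A₀ z ↔ IsIntegral D z := by
    intro z
    constructor
    · rintro ⟨p, hp, hpz⟩
      refine ⟨p.map e.symm.toRingHom, hp.map _, ?_⟩
      rw [Polynomial.eval₂_map]
      convert hpz using 1
      refine Polynomial.eval₂_congr ?_ rfl rfl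
      ext a
      change algebraMap D K (e.symm a) = (a : K)
      rw [← he, RingEquiv.apply_symm_apply]
    · rintro ⟨p, hp, hpz⟩
      refine ⟨p.map e.toRingHom, hp.map _, ?_⟩
      rw [Polynomial.eval₂_map]
      convert hpz using 1
      exact Polynomial.eval₂_congr (RingHom.ext fun d => he d) rfl rfl
  -- generators
  obtain ⟨s, hs⟩ := Module.Finite.fg_top (R := D) (M := integralClosure D K)
  refine ⟨⟨s.image fun c : integralClosure D K =>
    (⟨(c : K), (hint _).mpr c.2⟩ : integralClosure A₀ K), ?_⟩⟩
  rw [eq_top_iff]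
  rintro ⟨z, hz⟩ -
  have hzD : (⟨z, (hint z).mp hz⟩ : integralClosure D K) ∈ Submodule.span D (s : Set (integralClosure D K)) := by
    rw [hs]; exact Submodule.mem_top
  -- follow the `D`-linear combination
  have key : ∀ w ∈ Submodule.span D (s : Set (integralClosure D K)),
      (⟨(w : K), (hint _).mpr w.2⟩ : integralClosure A₀ K) ∈
        Submodule.span A₀ ((s.image fun c : integralClosure D K =>
          (⟨(c : K), (hint _).mpr c.2⟩ : integralClosure A₀ K)) :
          Set (integralClosure A₀ K)) := by
    intro w hw
    induction hw using Submodule.span_induction with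
    | mem w hw =>
      refine Submodule.subset_span ?_
      rw [Finset.coe_image]
      exact ⟨w, hw, rfl⟩
    | zero => exact Submodule.zero_mem _
    | add w₁ w₂ _ _ h₁ h₂ =>
      have : (⟨((w₁ + w₂ : integralClosure D K) : K), (hint _).mpr (w₁ + w₂).2⟩ : integralClosure A₀ K) =
          ⟨(w₁ : K), (hint _).mpr w₁.2⟩ + ⟨(w₂ : K), (hint _).mpr w₂.2⟩ := Subtype.ext rfl
      rw [this]
      exact Submodule.add_mem _ h₁ h₂
    | smul d w _ hw =>
      have : (⟨((d • w : integralClosure D K) : K), (hint _).mpr (d • w).2⟩ : integralClosure A₀ K) =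
          (e d) • ⟨(w : K), (hint _).mpr w.2⟩ := by
        apply Subtype.ext
        change ((d • w : integralClosure D K) : K) = ((e d : A₀) : K) * (w : K)
        rw [he, ← Algebra.smul_def]
        rfl
      rw [this]
      exact Submodule.smul_mem _ _ hw
  have := key _ hzD
  exact this

/-! ## Local G-rings -/

/-- **A one-dimensional Noetherian local domain which is a G-ring has finite normalization**: its
completion is reduced (Stacks 07QV: `R → R̂` regular and `R` reduced), so Krull's criterion
applies (Kollár Thm. 1.101). [cite: Kollar2007, Thm. 1.101] [cite: Matsumura1987, §32 p. 260] -/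
theorem module_finite_integralClosure_of_isGRing_of_ringKrullDim_eq_one (D : Type u) [CommRing D]
    [IsDomain D] [IsLocalRing D] (hD : IsGRing D) (hdim : ringKrullDim D = 1) :
    Module.Finite D (integralClosure D (FractionRing D)) := by
  haveI : IsNoetherianRing D := hD.1
  haveI : IsReduced (AdicCompletion (maximalIdeal D) D) := hD.isReduced_adicCompletion
  exact module_finite_integralClosure_of_isReduced_adicCompletion D hdim

/-- **The hypothesis `hFN` of Bennett's inequality holds for local G-rings** (hence for
quasi-excellent and excellent local rings): for a prime `𝔔` of `R` and a prime `𝔮'` of `R_𝔔`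
with `dim R_𝔔/𝔮' = 1`, the normalization of the one-dimensional local domain `R_𝔔/𝔮'` — through
its image in its fraction field — is finite (`R_𝔔/𝔮'` is again a G-ring).
[cite: HerrmannIkedaOrbanz1988, Thm. (30.2) (proof)] [cite: Matsumura1987, §32 p. 260] -/
theorem module_finite_integralClosure_range_localization_quotient_of_isGRing {R : Type u}
    [CommRing R] (hR : IsGRing R) (Q : Ideal R) [Q.IsPrime] (q' : Ideal (Localization.AtPrime Q))
    [q'.IsPrime] (hdim : ringKrullDim (Localization.AtPrime Q ⧸ q') = 1) :
    Module.Finite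
      (algebraMap (Localization.AtPrime Q ⧸ q') (FractionRing (Localization.AtPrime Q ⧸ q'))).range
      (integralClosure
        (algebraMap (Localization.AtPrime Q ⧸ q') (FractionRing (Localization.AtPrime Q ⧸ q'))).range
        (FractionRing (Localization.AtPrime Q ⧸ q'))) := by
  have h1 : IsGRing (Localization.AtPrime Q) := isGRing_of_isLocalization Q.primeCompl hR
  have h2 : IsGRing (Localization.AtPrime Q ⧸ q') :=
    isGRing_of_surjective (Ideal.Quotient.mk q') Ideal.Quotient.mk_surjective h1
  haveI : IsDomain (Localization.AtPrime Q ⧸ q') := Ideal.Quotient.isDomain q'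
  haveI : IsLocalRing (Localization.AtPrime Q ⧸ q') :=
    IsLocalRing.of_surjective' (Ideal.Quotient.mk q') Ideal.Quotient.mk_surjective
  exact module_finite_integralClosure_range
    (module_finite_integralClosure_of_isGRing_of_ringKrullDim_eq_one _ h2 hdim)

end Literature.AlgebraicGeometry.Resolution
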